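import Literature.MathematicalPhysics.QuantumLattice.HubbardTTPrimeThermalPressureZeeman
import HarnessLib

/-!
# The fixed-filling torus partition function of the 2D `t–t'` Hubbard model in a Zeeman field, and the UPPER
# half of its thermodynamic limit: `limsup L⁻² log Z_{N_L}^h(L) ≤ pressureTT'Zeeman β t t' U n h`

Topic `MathematicalPhysics/QuantumLattice` (family `hubbard`; stage S2 (iii) `T > 0`, the `T × H` axes of the
phase map). Sequel of `HubbardTTPrimeThermalPressureZeeman` (the number
`pressureTT'Zeeman β t t' U n h = sup_{x ∈ spinFibre n} [pressureTT'₂ β t t' U x (n−x) + βh(2x − n)]`); the lower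
half and the full limit are in `HubbardTTPrimeThermalPressureZeemanLimit`.

The finite-volume object is the CANONICAL partition function of the `L × L` torus at the particle number of record
`N = rectN n L` in a Zeeman field `h` coupled to `N↑ − N↓`: by the spin-sector block structure of
`hubbardRectTorusTT' L L t t' U − h·spinImbalance` (`partitionFn_sub_sub_re_eq_sum`) its trace over the `N`-particle
space is the sector sum

  `torusPartitionSumTT'Zeeman β t t' U h L N = Σ_{a = 0}^{N} e^{βh(a − (N−a))} · Re Z_β(hubbardRectTorusTT' L L t t' U; a, N − a)`

(empty sectors contribute `0`), and `torusPressureTT'Zeeman β t t' U n h L := L⁻² log` of it at `N = rectN n L`.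

* §1 finite volume: over-full sectors vanish; every sector term is below the sum; the sum of `N + 1` terms is at
  most `N + 1` times its largest term; the `S^z = 0` sector of record is one of the terms, so the sum is positive
  and `sectorPressureTT' β t t' U n L ≤ torusPressureTT'Zeeman β t t' U n h L` torus by torus at EVERY field;
* §2 **UPPER HALF OF THE LIMIT** (`β > 0`, `U ≥ 0`, `0 < n < 2`, every real `h`): for every `ε > 0`, eventually
  `torusPressureTT'Zeeman … L ≤ pressureTT'Zeeman … + ε` — at the supporting chemical potential `μ` of the filling
  (`P(μ,h) = p(n,h) + βμn`, `exists_chemicalPotential_gcPressureTT'Zeeman_eq`) every one of the `N + 1 ≤ 2L² + 1`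
  sector terms is `≤ e^{L²(P(μ,h)+ε/3) − βμN}` by the uniformity of the canonical limit over ALL spin sectors
  (`eventually_forall_sector_le_sSup_zeeman`), `log(N+1) ≤ 4L` and `N/L² → n`.

HONEST SCOPE: a finite-volume definition and one half of a limit; no certificate value; no phase word; no state
class. Two definitions with body; everything else PROVED, 0 sorry.

## Mathlib / tree search
REUSED: `partitionFn_spinSector_re_nonneg/_pos`, `nonempty_spinConfig`, `nonempty_szConfig`, `card_rectSites`,
`partitionFn_sectorHamiltonianTT'_eq_spinSector`, `partitionFn_spinSector_hubbardTorusTT'_eq_rect`,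
`tendsto_rectN_div_sq`, `rectN_le`, `eventually_forall_sector_le_sSup_zeeman`; Mathlib `Finset.single_le_sum`,
`Real.log_le_sub_one_of_pos`, `Real.exp_log`.

## References
* D. Ruelle, *Statistical Mechanics: Rigorous Results* (1969), §3.4. [cite: Ruelle1969, §3.4]
* R. B. Israel, *Convexity in the Theory of Lattice Gases* (1979), Thm. I.2.4, Lemma II.3.1. [cite: Israel1979, Thm. I.2.4]
* E. H. Lieb, Phys. Rev. Lett. 62 (1989) 1201, proof of Thm. 1. [cite: LiebPRL1989, proof of Theorem 1]
-/

noncomputable section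

namespace Literature.MathematicalPhysics.QuantumLattice

namespace ThermodynamicLimit

open _root_.Filter Set Finset Matrix
open scoped _root_.Topology BigOperators

/-! ### §1 The fixed-filling torus partition function in a Zeeman field -/

/-- **The canonical partition SUM of the `L × L` `t–t'` torus at particle number `N` in a Zeeman field `h`**:
`Σ_{a=0}^{N} e^{βh(a − (N − a))} Re Z_β(hubbardRectTorusTT' L L t t' U; a, N − a)` — the trace of
`e^{−β(H − h(N↑ − N↓))}` over the `N`-particle space, written through the spin-sector blocks of the
sector-preserving `H` (empty sectors contribute `0`). [cite: Ruelle1969, §3.4] -/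
def torusPartitionSumTT'Zeeman (β t t' U hz : ℝ) (L N : ℕ) : ℝ :=
  ∑ a ∈ Finset.range (N + 1), Real.exp (β * hz * ((a : ℝ) - ((N - a : ℕ) : ℝ))) *
    (partitionFn β (spinSectorHamiltonian a (N - a) (hubbardRectTorusTT' L L t t' U))).re

/-- **The finite-volume canonical pressure in a Zeeman field** at the particle number of record `N = rectN n L`:
`L⁻² · log torusPartitionSumTT'Zeeman β t t' U h L (rectN n L)`. [cite: Ruelle1969, §3.4] -/
def torusPressureTT'Zeeman (β t t' U n hz : ℝ) (L : ℕ) : ℝ :=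
  Real.log (torusPartitionSumTT'Zeeman β t t' U hz L (rectN n L)) / (L : ℝ) ^ 2

/-- An over-full spin sector of the `L × L` torus is empty, so its partition function vanishes.
[cite: LiebPRL1989, proof of Theorem 1] -/
theorem partitionFn_spinSector_re_eq_zero_of_lt (L : ℕ) (t t' U β : ℝ) {a b : ℕ} (h : L * L < a ∨ L * L < b) :
    (partitionFn β (spinSectorHamiltonian a b (hubbardRectTorusTT' L L t t' U))).re = 0 := by
  haveI : IsEmpty (Subtype (spinConfig (Λ := Fin L ×ₗ Fin L) a b)) := ⟨fun ⟨s, hs⟩ => by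
    have hu := Finset.card_le_univ (upPart s)
    have hd := Finset.card_le_univ (downPart s)
    rw [hs.1, card_rectSites] at hu
    rw [hs.2, card_rectSites] at hd
    omega⟩
  rw [(isHermitian_spinSectorHamiltonian a b (hubbardRectTorusTT'_isHermitian L L t t' U)).partitionFn_eq_ofReal,
    Complex.ofReal_re]
  simp

/-- Every sector term is nonnegative. [cite: Israel1979, Lemma II.3.1] -/
theorem torusPartitionSumTT'Zeeman_term_nonneg (β t t' U hz : ℝ) (L N a : ℕ) :
    0 ≤ Real.exp (β * hz * ((a : ℝ) - ((N - a : ℕ) : ℝ))) *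
      (partitionFn β (spinSectorHamiltonian a (N - a) (hubbardRectTorusTT' L L t t' U))).re :=
  mul_nonneg (Real.exp_pos _).le (partitionFn_spinSector_re_nonneg _ _ (hubbardRectTorusTT'_isHermitian L L t t' U) β)

/-- **Every sector of particle number `N` is below the sum**: `e^{βh(a−(N−a))} Re Z(a, N−a) ≤ Z_N^h` (`a ≤ N`).
[cite: Ruelle1969, §3.4] -/
theorem term_le_torusPartitionSumTT'Zeeman (β t t' U hz : ℝ) (L N : ℕ) {a : ℕ} (ha : a ≤ N) :
    Real.exp (β * hz * ((a : ℝ) - ((N - a : ℕ) : ℝ))) *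
        (partitionFn β (spinSectorHamiltonian a (N - a) (hubbardRectTorusTT' L L t t' U))).re ≤
      torusPartitionSumTT'Zeeman β t t' U hz L N :=
  Finset.single_le_sum (f := fun a : ℕ => Real.exp (β * hz * ((a : ℝ) - ((N - a : ℕ) : ℝ))) *
      (partitionFn β (spinSectorHamiltonian a (N - a) (hubbardRectTorusTT' L L t t' U))).re)
    (fun a _ => torusPartitionSumTT'Zeeman_term_nonneg β t t' U hz L N a) (Finset.mem_range.2 (Nat.lt_succ_of_le ha))

/-- **The sum is bounded by its largest term times the number of terms**: if every term is `≤ B` (`0 ≤ B`) then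
`Z_N^h ≤ (N + 1) B`. [cite: Ruelle1969, §3.4] -/
theorem torusPartitionSumTT'Zeeman_le_of_forall (β t t' U hz : ℝ) (L N : ℕ) {B : ℝ}
    (hB : ∀ a ≤ N, Real.exp (β * hz * ((a : ℝ) - ((N - a : ℕ) : ℝ))) *
      (partitionFn β (spinSectorHamiltonian a (N - a) (hubbardRectTorusTT' L L t t' U))).re ≤ B) :
    torusPartitionSumTT'Zeeman β t t' U hz L N ≤ ((N : ℝ) + 1) * B := by
  unfold torusPartitionSumTT'Zeeman
  calc _ ≤ ∑ _a ∈ Finset.range (N + 1), B :=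
        Finset.sum_le_sum fun a ha => hB a (Nat.lt_succ_iff.1 (Finset.mem_range.1 ha))
    _ = ((N : ℝ) + 1) * B := by rw [Finset.sum_const, Finset.card_range, nsmul_eq_mul]; push_cast; ring

/-- **The zero-field sector of record is one of the terms**: at `N = rectN n L = 2k`, `k = halfRectN n L`, the
`S^z = 0` term is `Re Z_β(sectorHamiltonianTT' t t' U n L)` (`log_partitionFn_sectorHamiltonianTT'_eq_rect`), so
`Re Z_β^{sector}(L) ≤ Z_{rectN n L}^h(L)` at EVERY field. [cite: LiebPRL1989, proof of Theorem 1] -/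
theorem partitionFn_sectorHamiltonianTT'_re_le_torusPartitionSum (β t t' U hz n : ℝ) (L : ℕ) :
    (partitionFn β (sectorHamiltonianTT' t t' U n L)).re ≤ torusPartitionSumTT'Zeeman β t t' U hz L (rectN n L) := by
  have e1 : rectN n L = 2 * halfRectN n L := rfl
  have hk : halfRectN n L ≤ rectN n L := by omega
  have h := term_le_torusPartitionSumTT'Zeeman β t t' U hz L (rectN n L) hk
  have hsub : rectN n L - halfRectN n L = halfRectN n L := by omega
  rw [hsub] at h
  have e : Real.exp (β * hz * ((halfRectN n L : ℝ) - (halfRectN n L : ℝ))) = 1 := by simp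
  rw [e, one_mul] at h
  rwa [partitionFn_sectorHamiltonianTT'_eq_spinSector, partitionFn_spinSector_hubbardTorusTT'_eq_rect]

/-- Hence **the zero-field canonical pressure of record is a floor at every field, torus by torus**:
`sectorPressureTT' β t t' U n L ≤ torusPressureTT'Zeeman β t t' U n h L` (`0 ≤ n ≤ 2`). [cite: LiebPRL1989, proof of Theorem 1] -/
theorem sectorPressureTT'_le_torusPressureTT'Zeeman (β t t' U hz : ℝ) {n : ℝ} (hn0 : 0 ≤ n) (hn2 : n ≤ 2) (L : ℕ) :
    sectorPressureTT' β t t' U n L ≤ torusPressureTT'Zeeman β t t' U n hz L := by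
  haveI := nonempty_szConfig hn0 hn2 L
  have hpos : 0 < (partitionFn β (sectorHamiltonianTT' t t' U n L)).re :=
    partitionFn_re_pos (isHermitian_sectorHamiltonianTT' t t' U n L) β
  unfold sectorPressureTT' torusPressureTT'Zeeman
  exact div_le_div_of_nonneg_right (Real.log_le_log hpos
    (partitionFn_sectorHamiltonianTT'_re_le_torusPartitionSum β t t' U hz n L)) (by positivity)

/-- The fixed-filling Zeeman partition sum is positive (`0 ≤ n ≤ 2`). [cite: Israel1979, Lemma II.3.1] -/
theorem torusPartitionSumTT'Zeeman_pos (β t t' U hz : ℝ) {n : ℝ} (hn0 : 0 ≤ n) (hn2 : n ≤ 2) (L : ℕ) :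
    0 < torusPartitionSumTT'Zeeman β t t' U hz L (rectN n L) := by
  haveI := nonempty_szConfig hn0 hn2 L
  exact (partitionFn_re_pos (isHermitian_sectorHamiltonianTT' t t' U n L) β).trans_le
    (partitionFn_sectorHamiltonianTT'_re_le_torusPartitionSum β t t' U hz n L)

/-! ### §2 The upper half of the thermodynamic limit -/

section Limit

variable {β : ℝ} (hβ : 0 < β) (t t' : ℝ) {U : ℝ} (hU : 0 ≤ U) {n : ℝ} (hn0 : 0 < n) (hn2 : n < 2) (hz : ℝ)
include hβ hU hn0 hn2

/-- **UPPER HALF** (`β > 0`, `U ≥ 0`, `0 < n < 2`): eventually `p_L(n,h) ≤ p(n,h) + ε`. At the supporting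
chemical potential `μ` of the filling (`P(μ,h) = p(n,h) + βμn`) every one of the `N + 1` sector terms is
`≤ e^{L²(P(μ,h)+ε/3) − βμN}` by the uniformity of the canonical limit over all spin sectors, and
`log(N+1) = o(L²)`, `N/L² → n`. [cite: Ruelle1969, §3.4] -/
theorem eventually_torusPressureTT'Zeeman_le {ε : ℝ} (hε : 0 < ε) :
    ∀ᶠ L : ℕ in atTop, torusPressureTT'Zeeman β t t' U n hz L ≤ pressureTT'Zeeman β t t' U n hz + ε := by
  obtain ⟨μ, hμ⟩ := exists_chemicalPotential_gcPressureTT'Zeeman_eq t t' hU hβ hz hn0 hn2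
  set P := gcPressureTT'Zeeman β t t' U μ hz with hP
  have hsec := eventually_forall_sector_le_sSup_zeeman hβ.le t t' hU μ hz (ε := ε / 3) (by positivity)
  -- `N/L² → n`
  have hN : ∀ᶠ L : ℕ in atTop, |β * μ| * |(rectN n L : ℝ) / (L : ℝ) ^ 2 - n| ≤ ε / 3 := by
    have h := tendsto_rectN_div_sq hn0.le
    have h' : Tendsto (fun L : ℕ => |β * μ| * |(rectN n L : ℝ) / (L : ℝ) ^ 2 - n|) atTop (𝓝 0) := by
      have := (tendsto_const_nhds (x := |β * μ|)).mul ((continuous_abs.tendsto _).comp (h.sub_const n))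
      simpa using this
    exact (h'.eventually (Iic_mem_nhds (by positivity : (0 : ℝ) < ε / 3)))
  -- `log(N+1) ≤ 4L ≤ (ε/3) L²`
  have hL : ∀ᶠ L : ℕ in atTop, (4 : ℝ) * L ≤ ε / 3 * (L : ℝ) ^ 2 := by
    filter_upwards [tendsto_natCast_atTop_atTop.eventually_ge_atTop (12 / ε)] with L hL
    have h1 : (12 : ℝ) ≤ ε * L := by rwa [div_le_iff₀ hε, mul_comm] at hL
    nlinarith [show (0 : ℝ) ≤ L by positivity]
  filter_upwards [hsec, hN, hL, eventually_ge_atTop 1] with L hsecL hNL hLL hL1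
  set N := rectN n L with hNdef
  have hL2 : (0 : ℝ) < (L : ℝ) ^ 2 := by
    have : (1 : ℝ) ≤ L := by exact_mod_cast hL1
    positivity
  have hHerm := hubbardRectTorusTT'_isHermitian L L t t' U
  -- every term is below `exp ((P + ε/3) L² − βμN)`
  have hterm : ∀ a ≤ N, Real.exp (β * hz * ((a : ℝ) - ((N - a : ℕ) : ℝ))) *
      (partitionFn β (spinSectorHamiltonian a (N - a) (hubbardRectTorusTT' L L t t' U))).re ≤
        Real.exp ((P + ε / 3) * (L : ℝ) ^ 2 - β * μ * N) := by
    intro a ha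
    by_cases hab : a ≤ L * L ∧ N - a ≤ L * L
    · haveI := nonempty_spinConfig (Λ := Fin L ×ₗ Fin L) (a := a) (b := N - a)
        (by rw [card_rectSites]; exact hab.1) (by rw [card_rectSites]; exact hab.2)
      have hZ : 0 < (partitionFn β (spinSectorHamiltonian a (N - a) (hubbardRectTorusTT' L L t t' U))).re :=
        partitionFn_spinSector_re_pos hHerm β
      have h := hsecL a (N - a) hab.1 hab.2
      rw [div_le_iff₀ hL2] at h
      have e : (a : ℝ) + ((N - a : ℕ) : ℝ) = N := by rw [Nat.cast_sub ha]; ring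
      rw [e] at h
      calc Real.exp (β * hz * ((a : ℝ) - ((N - a : ℕ) : ℝ))) *
            (partitionFn β (spinSectorHamiltonian a (N - a) (hubbardRectTorusTT' L L t t' U))).re
          = Real.exp (β * hz * ((a : ℝ) - ((N - a : ℕ) : ℝ)) +
              Real.log (partitionFn β (spinSectorHamiltonian a (N - a) (hubbardRectTorusTT' L L t t' U))).re) := by
            rw [Real.exp_add, Real.exp_log hZ]
        _ ≤ Real.exp ((P + ε / 3) * (L : ℝ) ^ 2 - β * μ * N) := Real.exp_le_exp.2 (by linarith)
    · have hzero := partitionFn_spinSector_re_eq_zero_of_lt L t t' U β (a := a) (b := N - a) (by omega)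
      rw [hzero, mul_zero]
      exact (Real.exp_pos _).le
  have hsum := torusPartitionSumTT'Zeeman_le_of_forall β t t' U hz L N hterm
  have hpos := torusPartitionSumTT'Zeeman_pos β t t' U hz hn0.le hn2.le L
  have hN1 : (0 : ℝ) < (N : ℝ) + 1 := by positivity
  have hlog : Real.log (torusPartitionSumTT'Zeeman β t t' U hz L N) ≤
      Real.log ((N : ℝ) + 1) + ((P + ε / 3) * (L : ℝ) ^ 2 - β * μ * N) := by
    have h := Real.log_le_log hpos hsum
    rwa [Real.log_mul hN1.ne' (Real.exp_pos _).ne', Real.log_exp] at h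
  -- `log (N+1) ≤ 4L`
  have hlogN : Real.log ((N : ℝ) + 1) ≤ 4 * L := by
    have hNle : (N : ℝ) ≤ 2 * (L : ℝ) ^ 2 := (rectN_le hn0.le L).trans (by nlinarith)
    have hL1r : (1 : ℝ) ≤ L := by exact_mod_cast hL1
    have h2L : (0 : ℝ) < 2 * L := by positivity
    calc Real.log ((N : ℝ) + 1) ≤ Real.log ((2 * L) * (2 * L)) :=
          Real.log_le_log hN1 (by nlinarith)
      _ = Real.log (2 * L) + Real.log (2 * L) := Real.log_mul h2L.ne' h2L.ne'
      _ ≤ 4 * L := by have := Real.log_le_sub_one_of_pos h2L; linarith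
  -- `βμ(nL² − N) ≤ (ε/3) L²`
  have hμN : β * μ * n * (L : ℝ) ^ 2 - β * μ * N ≤ ε / 3 * (L : ℝ) ^ 2 := by
    have e : β * μ * n * (L : ℝ) ^ 2 - β * μ * N = -(β * μ) * (((N : ℝ) / (L : ℝ) ^ 2 - n) * (L : ℝ) ^ 2) := by
      field_simp
      ring
    rw [e]
    have h1 : -(β * μ) * (((N : ℝ) / (L : ℝ) ^ 2 - n) * (L : ℝ) ^ 2) ≤
        |β * μ| * |(N : ℝ) / (L : ℝ) ^ 2 - n| * (L : ℝ) ^ 2 := by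
      have h0 := neg_abs_le (β * μ * (((N : ℝ) / (L : ℝ) ^ 2 - n)))
      rw [abs_mul] at h0
      have e1 : -(β * μ) * (((N : ℝ) / (L : ℝ) ^ 2 - n) * (L : ℝ) ^ 2) =
          -(β * μ * ((N : ℝ) / (L : ℝ) ^ 2 - n)) * (L : ℝ) ^ 2 := by ring
      rw [e1]
      exact mul_le_mul_of_nonneg_right (by linarith) hL2.le
    exact h1.trans (mul_le_mul_of_nonneg_right hNL hL2.le)
  unfold torusPressureTT'Zeeman
  rw [← hNdef, div_le_iff₀ hL2]
  have eP : P = pressureTT'Zeeman β t t' U n hz + β * μ * n := hμ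
  rw [eP] at hlog
  have e2 : (pressureTT'Zeeman β t t' U n hz + β * μ * n + ε / 3) * (L : ℝ) ^ 2 - β * μ * N =
      pressureTT'Zeeman β t t' U n hz * (L : ℝ) ^ 2 + ε / 3 * (L : ℝ) ^ 2 +
        (β * μ * n * (L : ℝ) ^ 2 - β * μ * N) := by ring
  rw [e2] at hlog
  linarith [hlog, hlogN, hLL, hμN]

end Limit

end ThermodynamicLimit

end Literature.MathematicalPhysics.QuantumLattice
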